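import Summits.BirchSwinnertonDyer.BirchSwinnertonDyer.Theorems.ClassRecordThreeRung62310y1HeightEvalSigma
import Summits.BirchSwinnertonDyer.BirchSwinnertonDyer.Theorems.ClassRecordThreeRegCertKernelLog
import HarnessLib

/-!
# Route `ClassRecordThree`, crux `SchneiderAtThree` (item 19106): THIRD-ORDER ingredient of the REG3CERT kernel evaluator —
# the Tate sigma product to FIRST order in `q`: `‖Π − (1 − 4q(c − 1))‖ ≤ ‖q‖²·‖c − 1‖`
# (cell `bsd-stepL`, seat `bsd-stepL-reg3-eng` g3; `--supports stmt-BirchSwinnertonDyer-19106`)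

HONEST FRAMING: BSD is not proved by any of this; a `3`-adic estimate, no statement about any curve. Refines
`norm_tprod_tateSigmaSq_factor_sub_one_le` (p425825: `‖Π − 1‖ ≤ ‖q‖‖c − 1‖`) by one order, as needed for `σ²` modulo
`3⁶` (`h mod 81`, REG3CERT rows with `v₃(h(Q)) = 3`): `Π = F₀·Π'` with `F₀ = (1 − 2qc + q²)²/(1 − q)⁴ =
1 − 4q(c − 1) + O(q²(c − 1))` and `‖Π' − 1‖ ≤ ‖q‖²‖c − 1‖` (the factors `n ≥ 2`). Theorems only (0 defs, 0 facts).
References: [SteinWuthrich2013] §4.2; [SilvermanATAEC1994] V.3.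
-/

open scoped Classical

open Filter Topology WeierstrassCurve Literature.NumberTheory.EllipticCurves
  Literature.NumberTheory.EllipticCurves.SteinWuthrich2013
  Summit.BirchSwinnertonDyer.Rank1Residual.X11b.RegMult.Rung62310y1

namespace Summit.BirchSwinnertonDyer.Rank1Residual.X11b.RegMult.KernelCert

/-- Ultrametric inequality for differences. [folklore] -/
private theorem norm_sub_le_max₆ (a b : ℚ_[3]) : ‖a - b‖ ≤ max ‖a‖ ‖b‖ := by
  rw [sub_eq_add_neg, ← norm_neg b]; exact IsUltrametricDist.norm_add_le_max a (-b)

/-- `‖1 − Q‖ = 1` for `‖Q‖ < 1`. [folklore] -/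
private theorem norm_one_sub_eq_one' {Q : ℚ_[3]} (hQ : ‖Q‖ < 1) : ‖1 - Q‖ = 1 := by
  have h : ‖((1 : ℚ_[3]) - Q) - 1‖ < ‖(1 : ℚ_[3])‖ := by
    rw [show ((1 : ℚ_[3]) - Q) - 1 = -Q by ring, norm_neg, norm_one]; exact hQ
  rw [Padic.norm_eq_of_norm_sub_lt_right h, norm_one]

/-- **The first sigma factor to first order**: `‖(1 − 2qc + q²)²/(1 − q)⁴ − (1 − 4q(c − 1))‖ ≤ ‖q‖²‖c − 1‖`
(`A = (1−q)² − 2q(c−1)`; `A² − (1 − 4q(c−1))(1−q)⁴ = 4q(c−1)(1−q)²(q² − 2q) + 4q²(c−1)²`). [cite: SteinWuthrich2013, §4.2] -/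
theorem norm_tateSigmaSq_factor_zero_sub_linear_le {q c : ℚ_[3]} (hq : ‖q‖ < 1) (hc : ‖c‖ ≤ 1) :
    ‖(1 - 2 * q ^ (0 + 1) * c + q ^ (2 * (0 + 1))) ^ 2 / (1 - q ^ (0 + 1)) ^ 4 - (1 - 4 * q * (c - 1))‖ ≤
      ‖q‖ ^ 2 * ‖c - 1‖ := by
  simp only [zero_add, pow_one, mul_one]
  have hB : ‖(1 - q) ^ 4‖ = 1 := by rw [norm_pow, norm_one_sub_eq_one' hq, one_pow]
  have hB0 : (1 - q) ^ 4 ≠ 0 := by intro h; rw [h, norm_zero] at hB; exact zero_ne_one hB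
  rw [div_sub' hB0, norm_div, hB, div_one]
  have hid : (1 - 2 * q * c + q ^ 2) ^ 2 - (1 - q) ^ 4 * (1 - 4 * q * (c - 1)) =
      4 * q * (c - 1) * (1 - q) ^ 2 * (q ^ 2 - 2 * q) + (2 * q * (c - 1)) ^ 2 := by ring
  rw [hid]
  have hc1 : ‖c - 1‖ ≤ 1 := (norm_sub_le_max₆ c 1).trans (max_le hc (by rw [norm_one]))
  have h4 : ‖(4 : ℚ_[3])‖ ≤ 1 := by
    rw [show (4 : ℚ_[3]) = ((4 : ℤ) : ℚ_[3]) by norm_cast]; exact Padic.norm_int_le_one _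
  have h2 : ‖(2 : ℚ_[3])‖ ≤ 1 := by
    rw [show (2 : ℚ_[3]) = ((2 : ℤ) : ℚ_[3]) by norm_cast]; exact Padic.norm_int_le_one _
  have hq2 : ‖q ^ 2 - 2 * q‖ ≤ ‖q‖ := by
    rw [show q ^ 2 - 2 * q = q * (q - 2) by ring, norm_mul]
    calc ‖q‖ * ‖q - 2‖ ≤ ‖q‖ * 1 := by
          gcongr; exact (norm_sub_le_max₆ q 2).trans (max_le hq.le h2)
      _ = ‖q‖ := mul_one _
  refine (IsUltrametricDist.norm_add_le_max _ _).trans (max_le ?_ ?_)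
  · rw [norm_mul, norm_mul, norm_mul, norm_mul, norm_pow, norm_one_sub_eq_one' hq, one_pow, mul_one]
    calc ‖(4 : ℚ_[3])‖ * ‖q‖ * ‖c - 1‖ * ‖q ^ 2 - 2 * q‖ ≤ 1 * ‖q‖ * ‖c - 1‖ * ‖q‖ := by gcongr
      _ = ‖q‖ ^ 2 * ‖c - 1‖ := by ring
  · rw [norm_pow, norm_mul, norm_mul]
    calc (‖(2 : ℚ_[3])‖ * ‖q‖ * ‖c - 1‖) ^ 2 ≤ (1 * ‖q‖ * ‖c - 1‖) ^ 2 := by gcongr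
      _ = ‖q‖ ^ 2 * ‖c - 1‖ * ‖c - 1‖ := by ring
      _ ≤ ‖q‖ ^ 2 * ‖c - 1‖ * 1 := by gcongr
      _ = ‖q‖ ^ 2 * ‖c - 1‖ := mul_one _

/-- **`Π = 1 − 4q(c − 1) + O(q²(c − 1))`**: for `‖q‖₃ < 1`, `‖c‖₃ ≤ 1`,
`‖∏'_{n≥1} (1 − 2qⁿc + q²ⁿ)²/(1 − qⁿ)⁴ − (1 − 4q(c − 1))‖ ≤ ‖q‖²·‖c − 1‖`: every partial product over a finite set
containing the first factor is `F₀·P'` with `‖P' − 1‖ ≤ ‖q‖²‖c − 1‖` (`norm_prod_sub_prod_le`), pass to the limit.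
[cite: SteinWuthrich2013, §4.2] -/
theorem norm_tprod_tateSigmaSq_factor_sub_linear_le {q c : ℚ_[3]} (hq : ‖q‖ < 1) (hc : ‖c‖ ≤ 1) :
    ‖(∏' n : ℕ, (1 - 2 * q ^ (n + 1) * c + q ^ (2 * (n + 1))) ^ 2 / (1 - q ^ (n + 1)) ^ 4) - (1 - 4 * q * (c - 1))‖ ≤
      ‖q‖ ^ 2 * ‖c - 1‖ := by
  have hmult := multipliable_tateSigmaSq_factor hq hc
  have hP0 := hmult.hasProd
  have h1 : Tendsto (fun _ : Finset ℕ ↦ (1 - 4 * q * (c - 1) : ℚ_[3])) atTop (𝓝 (1 - 4 * q * (c - 1))) :=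
    tendsto_const_nhds
  have hP := (hP0.sub h1).norm
  refine le_of_tendsto hP (Filter.eventually_atTop.2 ⟨{0}, fun s hs ↦ ?_⟩)
  have h0s : 0 ∈ s := hs (Finset.mem_singleton_self 0)
  have hC : 0 ≤ ‖q‖ ^ 2 * ‖c - 1‖ := by positivity
  have hc1 : ‖c - 1‖ ≤ 1 := (norm_sub_le_max₆ c 1).trans (max_le hc (by rw [norm_one]))
  -- the factors `n ≥ 1` are within `‖q‖²‖c − 1‖` of `1`; replace the factor `n = 0` by `1`
  let f : ℕ → ℚ_[3] := fun n ↦ (1 - 2 * q ^ (n + 1) * c + q ^ (2 * (n + 1))) ^ 2 / (1 - q ^ (n + 1)) ^ 4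
  let f' : ℕ → ℚ_[3] := fun n ↦ if n = 0 then 1 else f n
  have hfact : ∀ n : ℕ, ‖f n - 1‖ ≤ ‖q‖ ^ (n + 1) * ‖c - 1‖ ∧ ‖f n‖ = 1 := by
    intro n
    have hqn : ‖q ^ (n + 1)‖ < 1 := by rw [norm_pow]; exact pow_lt_one₀ (norm_nonneg _) hq (by omega)
    have heq : f n = (1 - 2 * q ^ (n + 1) * c + (q ^ (n + 1)) ^ 2) ^ 2 / (1 - q ^ (n + 1)) ^ 4 := by
      show (1 - 2 * q ^ (n + 1) * c + q ^ (2 * (n + 1))) ^ 2 / (1 - q ^ (n + 1)) ^ 4 = _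
      rw [← pow_mul, mul_comm (n + 1) 2]
    have h := norm_tateSigmaSq_factor_sub_one_le hqn hc
    rw [← heq, norm_pow] at h
    refine ⟨h, ?_⟩
    have hlt : ‖f n - 1‖ < ‖(1 : ℚ_[3])‖ := by
      rw [norm_one]; refine h.trans_lt ?_
      calc ‖q‖ ^ (n + 1) * ‖c - 1‖ ≤ ‖q‖ ^ (n + 1) * 1 := by gcongr
        _ < 1 := by rw [mul_one]; exact pow_lt_one₀ (norm_nonneg _) hq (by omega)
    rw [Padic.norm_eq_of_norm_sub_lt_right hlt, norm_one]
  have hP' : ‖∏ n ∈ s.erase 0, f n - 1‖ ≤ ‖q‖ ^ 2 * ‖c - 1‖ := by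
    have hcongr : ∏ n ∈ s.erase 0, f n = ∏ n ∈ s.erase 0, f' n :=
      Finset.prod_congr rfl fun n hn ↦ by
        have : n ≠ 0 := Finset.ne_of_mem_erase hn
        simp [f', this]
    have hf'1 : ∀ n, ‖f' n‖ ≤ 1 := fun n ↦ by
      by_cases hn : n = 0
      · simp [f', hn]
      · simp only [f', hn, if_false]; exact (hfact n).2.le
    have hf'd : ∀ n, ‖f' n - 1‖ ≤ ‖q‖ ^ 2 * ‖c - 1‖ := fun n ↦ by
      by_cases hn : n = 0
      · simp [f', hn]; positivity
      · simp only [f', hn, if_false]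
        refine (hfact n).1.trans ?_
        obtain ⟨k, rfl⟩ : ∃ k, n = k + 1 := ⟨n - 1, by omega⟩
        rw [show k + 1 + 1 = k + 2 by ring, pow_add]
        calc ‖q‖ ^ k * ‖q‖ ^ 2 * ‖c - 1‖ ≤ 1 * ‖q‖ ^ 2 * ‖c - 1‖ := by
              gcongr; exact pow_le_one₀ (norm_nonneg _) hq.le
          _ = ‖q‖ ^ 2 * ‖c - 1‖ := by rw [one_mul]
    have h := norm_prod_sub_prod_le (f := f') (g := fun _ : ℕ ↦ (1 : ℚ_[3])) hC hf'1
      (fun _ ↦ by rw [norm_one]) hf'd (s.erase 0)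
    rw [Finset.prod_const_one] at h
    rw [hcongr]; exact h
  have hF := norm_tateSigmaSq_factor_zero_sub_linear_le hq hc
  have hF0n : ‖f 0‖ ≤ 1 := (hfact 0).2.le
  show ‖∏ n ∈ s, f n - (1 - 4 * q * (c - 1))‖ ≤ ‖q‖ ^ 2 * ‖c - 1‖
  rw [← Finset.mul_prod_erase s f h0s,
    show f 0 * ∏ n ∈ s.erase 0, f n - (1 - 4 * q * (c - 1)) =
      f 0 * (∏ n ∈ s.erase 0, f n - 1) + (f 0 - (1 - 4 * q * (c - 1))) by ring]
  refine (IsUltrametricDist.norm_add_le_max _ _).trans (max_le ?_ hF)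
  rw [norm_mul]
  calc ‖f 0‖ * ‖∏ n ∈ s.erase 0, f n - 1‖ ≤ 1 * (‖q‖ ^ 2 * ‖c - 1‖) := by gcongr
    _ = ‖q‖ ^ 2 * ‖c - 1‖ := one_mul _

end Summit.BirchSwinnertonDyer.Rank1Residual.X11b.RegMult.KernelCert
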